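import Literature.AlgebraicGeometry.HodgeTheory.MonodromyMumfordTateHeredityCurves
import Literature.AlgebraicGeometry.HodgeTheory.HodgeGenericPointsAlmostAll
import HarnessLib

/-!
# HEREDITY of «a finite-index subgroup of monodromy lies in the Mumford–Tate group» off a MEAGRE set that is
# LEBESGUE-NULL in algebraic coordinates (any smooth base change; unconditional)

Null-currency twin of `MonodromyMumfordTateHeredityMeagre`: the genericity source is now
`HodgeGenericPointsAlmostAll.exists_nullMeagre_isHodgeGenericPoint` (Deligne 1972 Prop. 7.5 in its sharp analytic form:
the non-Hodge-generic points of a polarizable ℚ-VHS over a smooth quasi-projective base lie in a meagre set whose image under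
every algebraic chart, and under every map differentiable in the algebraic charts, is Lebesgue-null), instead of the merely
meagre form. Everything else is the H1 heredity step
`exists_finiteIndex_le_mumfordTateGroup_map_of_isHodgeGenericPoint_familyPullback` (CMSP (15.7) for the pulled-back family +
rational transport along a path).

Setting: `π : 𝒳 ⟶ S` smooth projective, `𝒳`, `S` quasi-projective, `S` smooth; `g : P ⟶ S` with `P` smooth quasi-projective of
relative dimension `d`, locally of finite type, `P(ℂ)` path connected. If at ONE point `c₀` a finite-index subgroup of the monodromy
group `Γ_{g c₀}` of `π` lies in `MT(Hᵏ(𝒳_{g c₀}))(ℚ)`, then off a meagre, chart-null `M ⊆ P(ℂ)` the same holds at `g c`.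

Main declarations
* `exists_nullMeagre_finiteIndex_le_mumfordTateGroup_of_baseChange` — the statement above (finite-index currency);
* `glIdentityComponent_subset_mumfordTateGroup_offNullMeagre_of_baseChange` — identity-component currency.

Honest frame: a statement about monodromy versus Mumford–Tate groups; it proves no case of the Hodge conjecture.
-/

namespace Literature.AlgebraicGeometry.HodgeTheory

open CategoryTheory _root_.AlgebraicGeometry
open _root_.Topology MeasureTheory
open Literature.AlgebraicGeometry.Motives
open Literature.AlgebraicTopology.SingularHomology

variable [HodgeTensorFacts.{0, 0}] {𝒳 S P : SchemeOver ℂ} (π : 𝒳 ⟶ S) (n k : ℕ)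
  (hf : IsSmoothProjectiveFamily π n) (hS : IsQuasiProjectiveOver S) (hSs : Smooth S.hom)
  (A : ∀ t : ComplexPoints S, HodgeModel n (fiberOver π t)) (hA : ∀ t, (A t).IsHodgeSymmetric)
  [∀ t : ComplexPoints S, Module.Finite ℚ (singularCohomology ℚ ℚ (ComplexPoints (fiberOver π t)) k)]
  [PathConnectedSpace (ComplexPoints P)] (g : P ⟶ S)

/-- **HEREDITY OFF A NULL MEAGRE SET, for every smooth projective family and every smooth algebraic sub-family** (unconditional).
`π : 𝒳 ⟶ S` smooth projective with `𝒳`, `S` quasi-projective, `S` smooth; `P` smooth quasi-projective of relative dimension `d`,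
locally of finite type, with `P(ℂ)` path connected; `g : P ⟶ S`. If at ONE point `c₀` some finite-index subgroup of the monodromy
group `Γ_{g c₀}` of `π` lies in `MT(Hᵏ(𝒳_{g c₀}))(ℚ)` (stated at `t₀ = g c₀`), then there is a MEAGRE `M ⊆ P(ℂ)`, NULL under every
map `F : P(ℂ) → ℂ^T` (`#T = d`) differentiable in the algebraic charts and null in every algebraic chart, such that the same holds at
`g c` for every `c ∉ M`. [cite: CarlsonMullerStachPeters2017, §15.3 (15.7) and Lemma–Definition 15.3.7]
[cite: Deligne1972WeilK3, Prop. 7.5] [cite: Andre1992, §4 Lemma 4] [cite: Mityagin2015, Proposition 1] -/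
theorem exists_nullMeagre_finiteIndex_le_mumfordTateGroup_of_baseChange (h𝒳 : IsQuasiProjectiveOver 𝒳)
    (d : ℕ) [SmoothOfRelativeDimension d P.hom] [LocallyOfFiniteType P.hom] (hPq : IsQuasiProjectiveOver P)
    (c₀ : ComplexPoints P) (t₀ : ComplexPoints S) (ht₀ : AlgPoints.map g c₀ = t₀)
    (hFI : letI hU := isCohomologicallyLocallyTrivialOn_univ_of_isQuasiProjectiveOver π hf hS hSs
      ∃ Γ₀ : Subgroup (singularCohomology ℚ ℚ (ComplexPoints (fiberOver π t₀)) k ≃ₗ[ℚ]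
          singularCohomology ℚ ℚ (ComplexPoints (fiberOver π t₀)) k),
        Γ₀ ≤ ratMonodromyGroup π k hU ⟨t₀, Set.mem_univ _⟩ ∧
        (Γ₀.subgroupOf (ratMonodromyGroup π k hU ⟨t₀, Set.mem_univ _⟩)).FiniteIndex ∧
        Γ₀ ≤ ((A t₀).hodgeStructure (hf.isSmoothProjective t₀) (hA t₀) k).mumfordTateGroup) :
    letI hU := isCohomologicallyLocallyTrivialOn_univ_of_isQuasiProjectiveOver π hf hS hSs
    ∃ M : Set (ComplexPoints P), IsMeagre M ∧
      (∀ (T : Type) [Fintype T], Fintype.card T = d → ∀ F : ComplexPoints P → (T → ℂ),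
        (∀ c₁ : ComplexPoints P, DifferentiableOn ℝ (F ∘ (ComplexPoints.algebraicChart P d c₁).symm)
          (ComplexPoints.algebraicChart P d c₁).target) →
        volume (F '' M) = 0) ∧
      (∀ c₁ : ComplexPoints P,
        volume (ComplexPoints.algebraicChart P d c₁ '' (M ∩ (ComplexPoints.algebraicChart P d c₁).source)) = 0) ∧
      ∀ c : ComplexPoints P, c ∉ M →
      ∃ Γ₁ : Subgroup (singularCohomology ℚ ℚ (ComplexPoints (fiberOver π (AlgPoints.map g c))) k ≃ₗ[ℚ]
          singularCohomology ℚ ℚ (ComplexPoints (fiberOver π (AlgPoints.map g c))) k),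
        Γ₁ ≤ ratMonodromyGroup π k hU ⟨AlgPoints.map g c, Set.mem_univ _⟩ ∧
        (Γ₁.subgroupOf (ratMonodromyGroup π k hU ⟨AlgPoints.map g c, Set.mem_univ _⟩)).FiniteIndex ∧
        Γ₁ ≤ ((A (AlgPoints.map g c)).hodgeStructure (hf.isSmoothProjective (AlgPoints.map g c))
          (hA (AlgPoints.map g c)) k).mumfordTateGroup := by
  subst ht₀
  have hU := isCohomologicallyLocallyTrivialOn_univ_of_isQuasiProjectiveOver π hf hS hSs
  haveI := hSs
  haveI : IsSeparated S.hom := hS.isVarietyPair_ofScheme.isSeparated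
  haveI hPs : Smooth P.hom := SmoothOfRelativeDimension.smooth d _
  -- ### the pulled-back family over `P`
  have hf' : IsSmoothProjectiveFamily (familyPullback.snd π g) n := hf.familyPullback_snd g
  have hU' := isCohomologicallyLocallyTrivialOn_univ_of_isQuasiProjectiveOver (familyPullback.snd π g) hf' hPq inferInstance
  have h𝒳' : IsQuasiProjectiveOver (familyPullback π g) := isQuasiProjectiveOver_familyPullback_of_isSeparated π g h𝒳 hPq
  haveI : ∀ c : ComplexPoints P, Module.Finite ℚ (singularCohomology ℚ ℚ (ComplexPoints (fiberOver (familyPullback.snd π g) c)) k) :=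
    fun c => BettiUniverse.finite (hf'.isSmoothProjective c) k
  have hAm' := fun c : ComplexPoints P => exists_isReal_hodgeModel_holds.exists_isHodgeSymmetric (hf'.isSmoothProjective c)
  let A' : ∀ c : ComplexPoints P, HodgeModel n (fiberOver (familyPullback.snd π g) c) := fun c => (hAm' c).choose
  have hA' : ∀ c, (A' c).IsHodgeSymmetric := fun c => (hAm' c).choose_spec
  -- ### Deligne 7.5, sharp analytic form: the non-generic points of `π'` lie in a meagre, chart-null set
  obtain ⟨M, hM, hnull, hchart, hgen⟩ :=
    exists_nullMeagre_isHodgeGenericPoint (familyPullback.snd π g) n k d hf' hPq h𝒳' hU' A' hA'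
  refine ⟨M, hM, hnull, hchart, fun c hc => ?_⟩
  have hgenc := hgen ⟨c, Set.mem_univ _⟩ hc
  -- ### a path `c ⇝ c₀` and the rational transport of `π'` along it
  let γ : Path c c₀ := PathConnectedSpace.somePath c c₀
  let γ' : Path (⟨c, Set.mem_univ _⟩ : (Set.univ : Set (ComplexPoints P))) ⟨c₀, Set.mem_univ _⟩ :=
    γ.map (f := fun x : ComplexPoints P => (⟨x, Set.mem_univ x⟩ : (Set.univ : Set (ComplexPoints P))))
      (continuous_id.subtype_mk _)
  have hrat' : ∀ (s t : (Set.univ : Set (ComplexPoints P))) (δ : Path.Homotopic.Quotient s t)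
      (α : complexBetti (fiberOver (familyPullback.snd π g) s.1) k),
      IsRationalClass α → IsRationalClass (transportFun (familyPullback.snd π g) k hU' δ α) :=
    fun s t δ α hα => isRationalClass_transportFun_of_isSmoothProjectiveFamily _ k d hf' hPq δ hα
  obtain ⟨T', hT'⟩ := exists_ratTransport (familyPullback.snd π g) k hU' hrat' ⟦γ'⟧
  -- ### HEREDITY H1
  exact exists_finiteIndex_le_mumfordTateGroup_map_of_isHodgeGenericPoint_familyPullback π g k hU hU' hf A hA A' hA' hgenc hT' hFI

/-- **Identity-component currency**: under the hypotheses of `exists_nullMeagre_finiteIndex_le_mumfordTateGroup_of_baseChange`, off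
a meagre `M ⊆ P(ℂ)` that is null in every algebraic chart, the identity component `(Γ_{g c}^Zar)°` of the monodromy group of `π` at
`g c` lies in `MT(Hᵏ(𝒳_{g c}))(ℚ)`. [cite: CarlsonMullerStachPeters2017, Lemma–Definition 15.3.7] [cite: Deligne1972WeilK3, Prop. 7.5] -/
theorem glIdentityComponent_subset_mumfordTateGroup_offNullMeagre_of_baseChange (h𝒳 : IsQuasiProjectiveOver 𝒳)
    (d : ℕ) [SmoothOfRelativeDimension d P.hom] [LocallyOfFiniteType P.hom] (hPq : IsQuasiProjectiveOver P)
    (c₀ : ComplexPoints P) (t₀ : ComplexPoints S) (ht₀ : AlgPoints.map g c₀ = t₀)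
    (hFI : letI hU := isCohomologicallyLocallyTrivialOn_univ_of_isQuasiProjectiveOver π hf hS hSs
      ∃ Γ₀ : Subgroup (singularCohomology ℚ ℚ (ComplexPoints (fiberOver π t₀)) k ≃ₗ[ℚ]
          singularCohomology ℚ ℚ (ComplexPoints (fiberOver π t₀)) k),
        Γ₀ ≤ ratMonodromyGroup π k hU ⟨t₀, Set.mem_univ _⟩ ∧
        (Γ₀.subgroupOf (ratMonodromyGroup π k hU ⟨t₀, Set.mem_univ _⟩)).FiniteIndex ∧
        Γ₀ ≤ ((A t₀).hodgeStructure (hf.isSmoothProjective t₀) (hA t₀) k).mumfordTateGroup) :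
    letI hU := isCohomologicallyLocallyTrivialOn_univ_of_isQuasiProjectiveOver π hf hS hSs
    ∃ M : Set (ComplexPoints P), IsMeagre M ∧
      (∀ c₁ : ComplexPoints P,
        volume (ComplexPoints.algebraicChart P d c₁ '' (M ∩ (ComplexPoints.algebraicChart P d c₁).source)) = 0) ∧
      ∀ c : ComplexPoints P, c ∉ M →
      glIdentityComponent (ratMonodromyGroup π k hU ⟨AlgPoints.map g c, Set.mem_univ _⟩) ⊆
        (((A (AlgPoints.map g c)).hodgeStructure (hf.isSmoothProjective (AlgPoints.map g c))
            (hA (AlgPoints.map g c)) k).mumfordTateGroup : Set _) := by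
  obtain ⟨M, hM, -, hchart, hC⟩ := exists_nullMeagre_finiteIndex_le_mumfordTateGroup_of_baseChange π n k hf hS hSs A hA g h𝒳 d
    hPq c₀ t₀ ht₀ hFI
  refine ⟨M, hM, hchart, fun c hc => ?_⟩
  obtain ⟨Γ₁, hle, hfi, hMT⟩ := hC c hc
  exact (glIdentityComponent_subset_of_finiteIndex hle hfi).trans (glZariskiClosure_subset_mumfordTateGroup _ hMT)

end Literature.AlgebraicGeometry.HodgeTheory
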